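import Summits.HodgeConjecture.HodgeConjecture.Theorems.LinearSystemTorelliLocalTubeSpanPlaneCalculus
import Mathlib.Tactic.Module

/-!
# Route LinearSystemTorelli — crux LocalTubeSpan (stmt-HodgeConjecture-2490): three squares make a pair move

Helper file (`--supports stmt-HodgeConjecture-2490`, line `Sketch` of the crux chain, cycle 9; the
lead's stub `stub_threeSquares`).

Setting: an alternating form `B` on a `ℚ`-space `V` and the squared transvections
`T_a² : v ↦ v - 2 B(v, a) a`.  For a `B`-orthogonal pair `e ⟂ f` (`B(e, f) = 0`) the word
`T_e² T_f² T_{e+f}⁻²` acts as the level-2 pair move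
`E_{e,f}² : v ↦ v + 2 (B(v, e) f + B(v, f) e)` (`localTubeSpan_threeSquares`): this turns the
squares of cycle 9 into all level-2 pair moves.

Proof: `T_{e+f}⁻² v = v + 2 B(v, e + f) (e + f)` (`localTubeSpan_sqMove_inv_apply`), then expand
`T_f²`, `T_e²` using `B(e, e) = B(f, f) = B(e, f) = B(f, e) = 0` and collect terms.

No named facts; no `sorry`.
-/

-- `Summit.HodgeConjecture.HodgeConjecture.Theorems` is the mandated namespace (single-conjunct summit:
-- Sub = Summit), which `linter.dupNamespace` flags on every declaration; the lakefile turns the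
-- linter off tree-wide (weak option), restated here so stand-alone elaboration is warning-free too.
set_option linter.dupNamespace false

noncomputable section

open Literature.AlgebraicGeometry.HodgeTheory

namespace Summit.HodgeConjecture.HodgeConjecture.Theorems

/-! ### Three squares make a pair move -/

section ThreeSquares

variable {V : Type} [AddCommGroup V] [Module ℚ V]

/-- **Three squares make a pair move.** For an alternating form `B` and a `B`-orthogonal pair
`e ⟂ f` (`B(e, f) = 0`), units `ge`, `gf`, `gef` of `End V` acting as the squared transvections
`T_e²`, `T_f²`, `T_{e+f}²` (`v ↦ v - 2 B(v, a) a` for `a = e, f, e + f`) satisfy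
`ge * gf * gef⁻¹ : v ↦ v + 2 (B(v, e) f + B(v, f) e)`, i.e. the word `T_e² T_f² T_{e+f}⁻²` is the
level-2 pair move `E_{e,f}²`. [folklore] -/
theorem localTubeSpan_threeSquares (B : LinearMap.BilinForm ℚ V) (hB : B.IsAlt) {e f : V}
    (hef : B e f = 0) (ge gf gef : (V →ₗ[ℚ] V)ˣ)
    (hge : ∀ v, (ge : V →ₗ[ℚ] V) v = v - (2 : ℚ) • (B v e • e))
    (hgf : ∀ v, (gf : V →ₗ[ℚ] V) v = v - (2 : ℚ) • (B v f • f))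
    (hgef : ∀ v, (gef : V →ₗ[ℚ] V) v = v - (2 : ℚ) • (B v (e + f) • (e + f))) (v : V) :
    ((ge * gf * gef⁻¹ : (V →ₗ[ℚ] V)ˣ) : V →ₗ[ℚ] V) v = v + (2 : ℚ) • (B v e • f + B v f • e) := by
  have hfe : B f e = 0 := by rw [← hB.neg_eq, hef, neg_zero]
  rw [Units.val_mul, Units.val_mul, Module.End.mul_apply, Module.End.mul_apply,
    localTubeSpan_sqMove_inv_apply B hB (e + f) gef hgef v, hgf, hge]
  simp only [map_add, map_sub, map_smul, LinearMap.add_apply, LinearMap.sub_apply,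
    LinearMap.smul_apply, smul_eq_mul, hB.self_eq_zero e, hB.self_eq_zero f, hef, hfe]
  module

end ThreeSquares

end Summit.HodgeConjecture.HodgeConjecture.Theorems

end
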